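/-
Copyright (c) 2026 the pub-hodgecm-mathlib formalisation cell (harness21).  Prover seat hodgecm-mathlib-K2E1-p09 (g5), Track B ∕ K2-LIT,
h413 = `stmt-HodgeConjecture-24833`, line `K2_E1_TraceFormulaBeta`, campaign «EIS-WHITTAKER-2» rung W4 of the dealer K2E1-plan (g4) 2026-09-04T06:58:37Z
(«`Σ_{ξ ∈ L⁺ˣ} |W_ξ(g,z)|` converges locally uniformly on `{Re z > ½} × 𝔖` … lattice machinery ★ (E2) … and the sum is holomorphic»), dealt 06:58:54Z (3) ∕ 07:12:50Z.
-/
import Summits.HodgeConjecture.HodgeConjecture.Theorems.K2E1AdelicFourierDecay     -- ★ (E2) (this seat, g4): `exists_forall_tsum_indicator_norm_mul_le_rpow_neg` — rational points of a decaying adelic function are summable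
import Mathlib.Analysis.Complex.LocallyUniformLimit                                 -- `Complex.differentiableOn_tsum_of_summable_norm`
import HarnessLib

/-!
# K2·E1 — `K2E1WhittakerSeriesConvergenceU2`: THE WHITTAKER ∕ FOURIER SERIES `Σ_{ξ ∈ Kˣ} W(z, ξ)` CONVERGES LOCALLY NORMALLY AND IS HOLOMORPHIC IN `z`
# (campaign «EIS-WHITTAKER-2», rung W4: the ADELIC LATTICE M-TEST — ★ (E2) at `t = 1` for a holomorphic FAMILY of decaying adelic functions, Weierstrass for the sum)

Track B ∕ K2-LIT, crux h413 = `stmt-HodgeConjecture-24833`, route of record `HCCMUnconditional`; cell `hodgecm-mathlib`, squad K2, ENGINE E1.  Prover seat `hodgecm-mathlib-K2E1-p09` (g5);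
rung W4 of the dealer K2E1-plan (g4)'s «EIS-WHITTAKER-2» (06:58:37Z), REPORT-FIRST 07:15:56Z.  THEOREMS ONLY (no `def`, no `instance`, no notation, no named-fact hypothesis, no `sorry`);
lane `--supports stmt-HodgeConjecture-24833 --as helper` (count-neutral).  Closes no socket.  Generic number field `K` (the campaign's `K = L⁺`).

THE MATHEMATICS [Garrett2018, §1.9–§1.10, §2.8; MoeglinWaldspurger1995, I.2.10; Bump1997, §3.7].  In the currency of W1 ★ `eisensteinSeriesU_sub_borelConstantTerm_eq_two`
(`E − E_B = μ(D)⁻¹·Σ_{ξ ∈ Kˣ} Φ̂_g(ξ)`) the Whittaker∕Fourier coefficients of the spherical Eisenstein series on `U(J₂)` are the values at the rational points `ξ ∈ Kˣ ⊂ 𝔸_K` of an adelic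
function `x ↦ W(z, x)` depending holomorphically on `z`; W2-arch ★ p858148 (`e^{−π|ξ_v|y_v∕√c}` at every real place, entire in `z`) and W2-fin∕W3 (a polynomial in `q_v^{−z}` supported on
`ord_v ξ ≥ −n_v`, divisor growth) give, locally uniformly in `z`, a bound `|W(z, x)| ≤ M·e^{−b‖x_∞‖}·(1 + ‖x_∞‖)^a` with `x_f`-support in a compact `C_f ⊂ 𝔸_{K,f}`.  This file is the
convergence∕holomorphy brick that turns such NAMED bounds into the locally normal convergence of `Σ_{ξ ≠ 0} W(z, ξ)` and the holomorphy of the sum: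
§1 **`exists_exp_neg_mul_rpow_le_rpow_neg`** — `∀ b > 0, ∀ a k, ∃ M ≥ 0, ∀ r ≥ 0, e^{−b r}·(1+r)^a ≤ M·(1+r)^{−k}` (`x^n∕n! ≤ e^x`): exponential decay beats every polynomial, so the
exponential currency feeds ★ (E2)'s polynomial one at ANY order `k`.
§2 **`exists_forall_summable_norm_ratPoints_of_decay`** — ★ (E2) `exists_forall_tsum_indicator_norm_mul_le_rpow_neg` at the idele `t = 1`: ONE `C` with `Summable (ξ ↦ ‖Ψ(ξ)‖)` and
`Σ_{ξ ≠ 0} ‖Ψ(ξ)‖ ≤ C` for EVERY `Ψ : 𝔸_K → ℂ` with `‖Ψ(x)‖ ≤ M·(1+‖x_∞‖)^{−k}` (`k > [K:ℚ]`) vanishing off `𝔸_{K,∞} × C_f`.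
§3 **`differentiableOn_tsum_of_locally_summable_norm`** — Weierstrass: `U` open, every `F_i` holomorphic on `U`, around every point of `U` a summable majorant ⟹ `z ↦ Σ' F_i z` holomorphic on
`U` (Mathlib `Complex.differentiableOn_tsum_of_summable_norm`, localised).
§3b **`continuousOn_tsum_of_locally_summable_norm`** — the same for `ContinuousOn` on an arbitrary set (Mathlib `continuousOn_tsum`, localised within the set).
§4 **`summable_majorant_ratPoints`** (the summable majorant `M·(1+‖ξ_∞‖)^{−k}·𝟙[ξ_f ∈ C_f]` over `ξ ∈ K`); HEADS **`summable_differentiableOn_tsum_of_rpow_bounds`** (LATTICE form, polynomial currency: `W : ℂ → K → ℂ`), **`summable_differentiableOn_tsum_of_exp_bounds`** (exponential currency), **`summable_differentiableOn_tsum_ratPoints_of_exp_bounds`** (ADELIC form `W : ℂ → 𝔸_K → ℂ`, W1's currency) and **`summable_continuousOn_tsum_of_rpow_bounds`** (`ContinuousOn` on any `S`, e.g. `{Re z ≥ ½}`): for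
`W : ℂ → 𝔸_K → ℂ` with (hWhol) `z ↦ W(z, ξ)` holomorphic on the open `U` for every `ξ ∈ Kˣ` and (hWbd) around every `z₀ ∈ U` a neighbourhood `V` with ONE bound of the above shape and ONE
compact finite support: (i) `∀ z ∈ U, Summable (ξ ↦ ‖W(z, ξ)‖)`; (ii) around every `z₀ ∈ U` ONE `C` with `Σ_{ξ≠0} ‖W(z, ξ)‖ ≤ C` on `V` (locally uniform convergence); (iii)
`z ↦ Σ_{ξ ≠ 0} W(z, ξ)` is holomorphic on `U`.  (hWhol), (hWbd) at `U = {Re z > ½}` are W2∕W3's outputs (the non-vanishing of `ζ_K(2z)` on `Re 2z ≥ 1` lives there); the `g ∈ 𝔖`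
uniformity is obtained by quantifying `W` over `g` with the same constants (the bound (ii) depends only on `M, k, C_f`).
HONEST LABEL: HC_CM is proved only modulo the 7 printed citations (2 remaining named inputs: hLiu418 = `stmt-HodgeConjecture-24832`, h413 = `stmt-HodgeConjecture-24833`) until rung 0
closes; this file asserts no named fact, closes no socket and crosses no ceiling by itself (the arithmetic bounds are W2∕W3's).
References: [Garrett2018] P. Garrett, *Modern Analysis of Automorphic Forms by Example* 1 (2018), §1.9–§1.10, §2.8 · [MoeglinWaldspurger1995] I.2.10 · [Bump1997] D. Bump, *Automorphic Forms and
Representations* (1997), §3.7 · [WeilBNT1967] Ch. IV §2 (lattices in `𝔸_K`).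
-/

set_option autoImplicit false
-- the mandated namespace repeats the single-problem summit's segment (`HodgeConjecture.HodgeConjecture`)
set_option linter.dupNamespace false

noncomputable section

open scoped NNReal Topology Classical Nat
open NumberField NumberField.mixedEmbedding IsDedekindDomain Set Filter Module
open Literature.NumberTheory.Automorphic Literature.NumberTheory.GaloisRepresentations
open Summit.HodgeConjecture.HodgeConjecture.Cruxes.H413.K2E1AdelicFourierDecay (exists_forall_tsum_indicator_norm_mul_le_rpow_neg)

namespace Summit.HodgeConjecture.HodgeConjecture.Cruxes.H413.K2E1WhittakerSeriesConvergenceU2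

/-! ## §1 Exponential decay beats every polynomial -/

/-- **`e^{−b r}·(1+r)^a ≤ M·(1+r)^{−k}` for `r ≥ 0`** (`b > 0`, any real `a`, `k`): with `n ≥ a + k`, `(1+r)^{a+k} ≤ (1+r)^n ≤ n!·b^{−n}·e^{b(1+r)}` (`x^n∕n! ≤ e^x`), so
`M = n!·e^b∕b^n` works. [folklore] -/
theorem exists_exp_neg_mul_rpow_le_rpow_neg {b : ℝ} (hb : 0 < b) (a k : ℝ) :
    ∃ M : ℝ, 0 ≤ M ∧ ∀ r : ℝ, 0 ≤ r → Real.exp (-(b * r)) * (1 + r) ^ a ≤ M * (1 + r) ^ (-k) := by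
  obtain ⟨n, hn⟩ : ∃ n : ℕ, a + k ≤ n := ⟨⌈a + k⌉₊, Nat.le_ceil _⟩
  refine ⟨n ! * Real.exp b / b ^ n, by positivity, fun r hr => ?_⟩
  have hx1 : 1 ≤ 1 + r := by linarith
  have hx0 : 0 < 1 + r := by linarith
  have h1 : (1 + r) ^ a = (1 + r) ^ (a + k) * (1 + r) ^ (-k) := by
    rw [← Real.rpow_add hx0]; ring_nf
  have h2 : (1 + r) ^ (a + k) ≤ (1 + r) ^ (n : ℝ) := Real.rpow_le_rpow_of_exponent_le hx1 hn
  have h3 : (b * (1 + r)) ^ n / n ! ≤ Real.exp (b * (1 + r)) := Real.pow_div_factorial_le_exp (b * (1 + r)) (by positivity) n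
  have hbn : 0 < b ^ n := pow_pos hb n
  have hfact : (0 : ℝ) < n ! := by positivity
  have h4 : (1 + r) ^ (n : ℝ) ≤ n ! / b ^ n * Real.exp (b * (1 + r)) := by
    rw [Real.rpow_natCast, div_mul_eq_mul_div, le_div_iff₀ hbn]
    rw [mul_pow, div_le_iff₀ hfact] at h3
    calc (1 + r) ^ n * b ^ n = b ^ n * (1 + r) ^ n := mul_comm _ _
      _ ≤ Real.exp (b * (1 + r)) * n ! := h3
      _ = n ! * Real.exp (b * (1 + r)) := mul_comm _ _
  have h5 : Real.exp (b * (1 + r)) = Real.exp b * Real.exp (b * r) := by rw [← Real.exp_add]; ring_nf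
  have h6 : Real.exp (-(b * r)) * Real.exp (b * r) = 1 := by rw [← Real.exp_add, neg_add_cancel, Real.exp_zero]
  have hk0 : 0 ≤ (1 + r) ^ (-k) := Real.rpow_nonneg hx0.le _
  have he0 : 0 ≤ Real.exp (-(b * r)) := Real.exp_nonneg _
  calc Real.exp (-(b * r)) * (1 + r) ^ a = Real.exp (-(b * r)) * ((1 + r) ^ (a + k) * (1 + r) ^ (-k)) := by rw [h1]
    _ ≤ Real.exp (-(b * r)) * ((1 + r) ^ (n : ℝ) * (1 + r) ^ (-k)) := by gcongr
    _ ≤ Real.exp (-(b * r)) * ((n ! / b ^ n * Real.exp (b * (1 + r))) * (1 + r) ^ (-k)) := by gcongr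
    _ = (Real.exp (-(b * r)) * Real.exp (b * r)) * (n ! * Real.exp b / b ^ n * (1 + r) ^ (-k)) := by rw [h5]; ring
    _ = n ! * Real.exp b / b ^ n * (1 + r) ^ (-k) := by rw [h6, one_mul]

/-! ## §2 ★ (E2) at the idele `t = 1`: the rational points of a decaying adelic function are absolutely summable, with ONE bound -/

variable (K : Type) [Field K] [NumberField K]

/-- **★ (E2) AT `t = 1`**: for `k > [K:ℚ]`, `M ≥ 0` and a compact `C_f ⊂ 𝔸_{K,f}` there is ONE `C ≥ 0` with `Summable (ξ ↦ ‖Ψ(ξ)‖)` and `Σ_{ξ ≠ 0} ‖Ψ(ξ)‖ ≤ C` for EVERY `Ψ : 𝔸_K → ℂ`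
with `‖Ψ(x)‖ ≤ M·(1+‖x_∞‖)^{−k}` vanishing unless `x_f ∈ C_f` (★ `exists_forall_tsum_indicator_norm_mul_le_rpow_neg` with `θ = k`, `t = 1`, `‖1‖ = 1`). [cite: WeilBNT1967, Ch. IV §2]
[cite: Garrett2018, §1.9] -/
theorem exists_forall_summable_norm_ratPoints_of_decay {k : ℕ} (hk : finrank ℚ K < k) {M : ℝ} (hM0 : 0 ≤ M)
    {Cf : Set (FiniteAdeleRing (𝓞 K) K)} (hCfc : IsCompact Cf) :
    ∃ C : ℝ, 0 ≤ C ∧ ∀ Ψ : AdeleRing (𝓞 K) K → ℂ,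
      (∀ x, ‖Ψ x‖ ≤ M * (1 + ‖InfiniteAdeleRing.ringEquiv_mixedSpace K x.1‖) ^ (-(k : ℝ))) → (∀ x, x.2 ∉ Cf → Ψ x = 0) →
        Summable (fun ξ : K => ‖Ψ (algebraMap K (AdeleRing (𝓞 K) K) ξ)‖) ∧
        ∑' ξ : K, ({0}ᶜ : Set K).indicator (fun ξ => ‖Ψ (algebraMap K (AdeleRing (𝓞 K) K) ξ)‖) ξ ≤ C := by
  have hθ : (finrank ℚ K : ℝ) < (k : ℝ) := by exact_mod_cast hk
  obtain ⟨C, hC0, hC⟩ := exists_forall_tsum_indicator_norm_mul_le_rpow_neg K hM0 hCfc hθ le_rfl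
  refine ⟨C, hC0, fun Ψ hM hCf => ?_⟩
  obtain ⟨hsum, hle⟩ := hC Ψ hM hCf 1
  simp only [Units.val_one, mul_one, map_one, NNReal.coe_one, Real.one_rpow] at hsum hle
  exact ⟨hsum, hle⟩

/-! ## §3 Weierstrass: a locally normally convergent series of holomorphic functions is holomorphic -/

/-- **HOLOMORPHY OF A LOCALLY NORMALLY CONVERGENT SERIES**: `U ⊆ ℂ` open, every `F_i` holomorphic on `U`, and around every point of `U` a neighbourhood with a summable majorant of the
`‖F_i‖` ⟹ `z ↦ Σ' F_i z` is holomorphic on `U` (Mathlib `Complex.differentiableOn_tsum_of_summable_norm` on the interior of the neighbourhood; differentiability is local). [cite: Bump1997, §3.7] -/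
theorem differentiableOn_tsum_of_locally_summable_norm {ι : Type*} {E : Type*} [NormedAddCommGroup E] [NormedSpace ℂ E] [CompleteSpace E]
    {F : ι → ℂ → E} {U : Set ℂ} (hU : IsOpen U) (hf : ∀ i, DifferentiableOn ℂ (F i) U)
    (hloc : ∀ z ∈ U, ∃ V ∈ 𝓝 z, ∃ u : ι → ℝ, Summable u ∧ ∀ i, ∀ w ∈ V, ‖F i w‖ ≤ u i) :
    DifferentiableOn ℂ (fun w => ∑' i, F i w) U := by
  intro z hz
  obtain ⟨V, hV, u, hu, hle⟩ := hloc z hz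
  have hW : IsOpen (interior (V ∩ U)) := isOpen_interior
  have hzW : z ∈ interior (V ∩ U) := mem_interior_iff_mem_nhds.2 (Filter.inter_mem hV (hU.mem_nhds hz))
  have hd : DifferentiableOn ℂ (fun w => ∑' i, F i w) (interior (V ∩ U)) :=
    Complex.differentiableOn_tsum_of_summable_norm hu (fun i => (hf i).mono (interior_subset.trans Set.inter_subset_right)) hW
      (fun i w hw => hle i w (interior_subset hw).1)
  exact ((hd z hzW).differentiableAt (hW.mem_nhds hzW)).differentiableWithinAt

/-- **CONTINUITY OF A LOCALLY NORMALLY CONVERGENT SERIES** on an arbitrary set `S` (for W5's «continuous up to `Re z = ½`» clause): every `F_i` continuous on `S` and around every point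
of `S` a neighbourhood WITHIN `S` with a summable majorant ⟹ `z ↦ Σ' F_i z` continuous on `S` (Mathlib `continuousOn_tsum`, localised). [cite: Bump1997, §3.7] -/
theorem continuousOn_tsum_of_locally_summable_norm {ι : Type*} {X : Type*} [TopologicalSpace X] {E : Type*} [NormedAddCommGroup E] [CompleteSpace E]
    {F : ι → X → E} {S : Set X} (hf : ∀ i, ContinuousOn (F i) S)
    (hloc : ∀ z ∈ S, ∃ V ∈ 𝓝[S] z, ∃ u : ι → ℝ, Summable u ∧ ∀ i, ∀ w ∈ V, ‖F i w‖ ≤ u i) :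
    ContinuousOn (fun w => ∑' i, F i w) S := by
  intro z hz
  obtain ⟨V, hV, u, hu, hle⟩ := hloc z hz
  have hc : ContinuousOn (fun w => ∑' i, F i w) (V ∩ S) :=
    continuousOn_tsum (fun i => (hf i).mono Set.inter_subset_right) hu (fun i w hw => hle i w hw.1)
  have hzV : z ∈ V := mem_of_mem_nhdsWithin hz hV
  exact (hc z ⟨hzV, hz⟩).mono_of_mem_nhdsWithin (Filter.inter_mem hV self_mem_nhdsWithin)

/-! ## §4 The heads: `Σ_{ξ ∈ Kˣ} W(z, ξ)` for a family of lattice functions with polynomial ∕ exponential decay -/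

/-- **THE SUMMABLE MAJORANT**: for `k > [K:ℚ]`, `M ≥ 0`, `C_f ⊂ 𝔸_{K,f}` compact, `u(ξ) := M·(1+‖ξ_∞‖)^{−k}·𝟙[ξ_f ∈ C_f]` is summable over `ξ ∈ K` and non-negative (§2 at the adelic
majorant `x ↦ M·(1+‖x_∞‖)^{−k}·𝟙_{C_f}(x_f)`). [cite: WeilBNT1967, Ch. IV §2] -/
theorem summable_majorant_ratPoints {k : ℕ} (hk : finrank ℚ K < k) {M : ℝ} (hM0 : 0 ≤ M) {Cf : Set (FiniteAdeleRing (𝓞 K) K)} (hCfc : IsCompact Cf) :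
    Summable (fun ξ : K => if (algebraMap K (AdeleRing (𝓞 K) K) ξ).2 ∈ Cf then M * (1 + ‖InfiniteAdeleRing.ringEquiv_mixedSpace K (algebraMap K (AdeleRing (𝓞 K) K) ξ).1‖) ^ (-(k : ℝ)) else 0) ∧
    ∀ ξ : K, 0 ≤ (if (algebraMap K (AdeleRing (𝓞 K) K) ξ).2 ∈ Cf then M * (1 + ‖InfiniteAdeleRing.ringEquiv_mixedSpace K (algebraMap K (AdeleRing (𝓞 K) K) ξ).1‖) ^ (-(k : ℝ)) else 0) := by
  obtain ⟨C, -, hC⟩ := exists_forall_summable_norm_ratPoints_of_decay K hk hM0 hCfc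
  have hn : ∀ x : AdeleRing (𝓞 K) K, 0 ≤ M * (1 + ‖InfiniteAdeleRing.ringEquiv_mixedSpace K x.1‖) ^ (-(k : ℝ)) := fun x =>
    mul_nonneg hM0 (Real.rpow_nonneg (by positivity) _)
  set Ψ₀ : AdeleRing (𝓞 K) K → ℂ := fun x => if x.2 ∈ Cf then ((M * (1 + ‖InfiniteAdeleRing.ringEquiv_mixedSpace K x.1‖) ^ (-(k : ℝ)) : ℝ) : ℂ) else 0 with hΨ₀
  have hnorm : ∀ x : AdeleRing (𝓞 K) K, ‖Ψ₀ x‖ = if x.2 ∈ Cf then M * (1 + ‖InfiniteAdeleRing.ringEquiv_mixedSpace K x.1‖) ^ (-(k : ℝ)) else 0 := fun x => by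
    by_cases hx : x.2 ∈ Cf
    · rw [hΨ₀]; dsimp only; rw [if_pos hx, if_pos hx, Complex.norm_real, Real.norm_of_nonneg (hn x)]
    · rw [hΨ₀]; dsimp only; rw [if_neg hx, if_neg hx, norm_zero]
  have hΨ₀b : ∀ x : AdeleRing (𝓞 K) K, ‖Ψ₀ x‖ ≤ M * (1 + ‖InfiniteAdeleRing.ringEquiv_mixedSpace K x.1‖) ^ (-(k : ℝ)) := fun x => by
    rw [hnorm]; split_ifs
    · exact le_rfl
    · exact hn x
  have hΨ₀s : ∀ x : AdeleRing (𝓞 K) K, x.2 ∉ Cf → Ψ₀ x = 0 := fun x hx => by rw [hΨ₀]; dsimp only; rw [if_neg hx]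
  obtain ⟨hsum0, -⟩ := hC Ψ₀ hΨ₀b hΨ₀s
  refine ⟨hsum0.congr fun ξ => hnorm _, fun ξ => ?_⟩
  split_ifs
  · exact hn _
  · exact le_rfl

/-- **W4, POLYNOMIAL CURRENCY** (lattice form): `W : ℂ → K → ℂ` with `z ↦ W(z, ξ)` holomorphic on the open `U` for every `ξ ∈ Kˣ`, and around every `z₀ ∈ U` a neighbourhood `V` with ONE
bound `‖W(z, ξ)‖ ≤ M·(1+‖ξ_∞‖)^{−k}` (`k > [K:ℚ]`, `‖ξ_∞‖` the sup norm of `ξ` in `K_∞ ≅ ℝ^{r₁} × ℂ^{r₂}`) and ONE compact `C_f ⊂ 𝔸_{K,f}` with `W(z, ξ) = 0` unless `ξ_f ∈ C_f` (a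
fractional-ideal support) ⟹ (i) `Σ_ξ ‖W(z, ξ)‖` summable for every `z ∈ U`; (ii) around every `z₀ ∈ U` ONE `C` with `Σ_{ξ≠0} ‖W(z, ξ)‖ ≤ C` on the neighbourhood (locally uniform convergence);
(iii) `z ↦ Σ_{ξ≠0} W(z, ξ)` holomorphic on `U`. [cite: Garrett2018, §1.9–§1.10 and §2.8] [cite: MoeglinWaldspurger1995, I.2.10] -/
theorem summable_differentiableOn_tsum_of_rpow_bounds {U : Set ℂ} (hU : IsOpen U) {W : ℂ → K → ℂ}
    (hWhol : ∀ ξ : K, ξ ≠ 0 → DifferentiableOn ℂ (fun z => W z ξ) U)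
    (hWbd : ∀ z₀ ∈ U, ∃ V ∈ 𝓝 z₀, ∃ (M : ℝ) (k : ℕ) (Cf : Set (FiniteAdeleRing (𝓞 K) K)), 0 ≤ M ∧ finrank ℚ K < k ∧ IsCompact Cf ∧
      ∀ z ∈ V, ∀ ξ : K, ‖W z ξ‖ ≤ M * (1 + ‖InfiniteAdeleRing.ringEquiv_mixedSpace K (algebraMap K (AdeleRing (𝓞 K) K) ξ).1‖) ^ (-(k : ℝ)) ∧
        ((algebraMap K (AdeleRing (𝓞 K) K) ξ).2 ∉ Cf → W z ξ = 0)) :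
    (∀ z ∈ U, Summable fun ξ : K => ‖W z ξ‖) ∧
    (∀ z₀ ∈ U, ∃ V ∈ 𝓝 z₀, ∃ C : ℝ, ∀ z ∈ V, ∑' ξ : K, ({0}ᶜ : Set K).indicator (fun ξ => ‖W z ξ‖) ξ ≤ C) ∧
    DifferentiableOn ℂ (fun z => ∑' ξ : K, ({0}ᶜ : Set K).indicator (fun ξ => W z ξ) ξ) U := by
  -- around every `z₀`: the summable majorant `u` of `summable_majorant_ratPoints` dominates `‖W z ·‖` and its `{0}ᶜ`-indicator on the neighbourhood
  have key : ∀ z₀ ∈ U, ∃ V ∈ 𝓝 z₀, ∃ u : K → ℝ, Summable u ∧ (∀ z ∈ V, ∀ ξ : K, ‖W z ξ‖ ≤ u ξ) ∧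
      ∀ z ∈ V, ∀ ξ : K, ‖({0}ᶜ : Set K).indicator (fun ξ => W z ξ) ξ‖ ≤ u ξ := by
    intro z₀ hz₀
    obtain ⟨V, hV, M, k, Cf, hM0, hk, hCfc, hbd⟩ := hWbd z₀ hz₀
    obtain ⟨hu, hu0⟩ := summable_majorant_ratPoints K hk hM0 hCfc
    have hdom : ∀ z ∈ V, ∀ ξ : K, ‖W z ξ‖ ≤ (if (algebraMap K (AdeleRing (𝓞 K) K) ξ).2 ∈ Cf then M * (1 + ‖InfiniteAdeleRing.ringEquiv_mixedSpace K (algebraMap K (AdeleRing (𝓞 K) K) ξ).1‖) ^ (-(k : ℝ)) else 0) := by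
      intro z hz ξ
      split_ifs with hx
      · exact (hbd z hz ξ).1
      · rw [(hbd z hz ξ).2 hx, norm_zero]
    refine ⟨V, hV, _, hu, hdom, fun z hz ξ => ?_⟩
    by_cases hξ : ξ = 0
    · simp only [hξ, Set.mem_compl_iff, Set.mem_singleton_iff, not_true_eq_false, not_false_eq_true, Set.indicator_of_notMem, norm_zero]
      exact hu0 0
    · simp only [Set.mem_compl_iff, Set.mem_singleton_iff, hξ, not_false_eq_true, Set.indicator_of_mem]
      exact hdom z hz ξ
  refine ⟨fun z hz => ?_, fun z₀ hz₀ => ?_, ?_⟩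
  · obtain ⟨V, hV, u, hu, hdom, -⟩ := key z hz
    exact Summable.of_nonneg_of_le (fun _ => norm_nonneg _) (hdom z (mem_of_mem_nhds hV)) hu
  · obtain ⟨V, hV, u, hu, -, hdom'⟩ := key z₀ hz₀
    refine ⟨V, hV, ∑' ξ, u ξ, fun z hz => ?_⟩
    have hle : ∀ ξ : K, ({0}ᶜ : Set K).indicator (fun ξ => ‖W z ξ‖) ξ ≤ u ξ := fun ξ => by
      have h := hdom' z hz ξ
      rwa [norm_indicator_eq_indicator_norm] at h
    exact Summable.tsum_le_tsum hle (Summable.of_nonneg_of_le (fun ξ => Set.indicator_nonneg (fun _ _ => norm_nonneg _) ξ) hle hu) hu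
  · refine differentiableOn_tsum_of_locally_summable_norm hU (fun ξ => ?_) (fun z₀ hz₀ => ?_)
    · by_cases hξ : ξ = 0
      · simp only [hξ, Set.mem_compl_iff, Set.mem_singleton_iff, not_true_eq_false, not_false_eq_true, Set.indicator_of_notMem]
        exact differentiableOn_const 0
      · simp only [Set.mem_compl_iff, Set.mem_singleton_iff, hξ, not_false_eq_true, Set.indicator_of_mem]
        exact hWhol ξ hξ
    · obtain ⟨V, hV, u, hu, -, hdom'⟩ := key z₀ hz₀
      exact ⟨V, hV, u, hu, fun ξ w hw => hdom' w hw ξ⟩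

/-- **W4, EXPONENTIAL CURRENCY** (lattice form; the shape W2-arch ★ p858148 ∕ W2-fin ∕ W3 deliver): the same three conclusions from, around every `z₀ ∈ U`, ONE bound
`‖W(z, ξ)‖ ≤ M·e^{−b‖ξ_∞‖}·(1+‖ξ_∞‖)^a` (`b > 0`, any real `a` — divisor-sum growth; `Σ_v |ξ_v| ≥ ‖ξ_∞‖` so per-place decay implies this) and ONE compact `ξ_f`-support, via §1 at
`k = [K:ℚ] + 1` and the polynomial head. [cite: Garrett2018, §1.9–§1.10 and §2.8] [cite: MoeglinWaldspurger1995, I.2.10] -/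
theorem summable_differentiableOn_tsum_of_exp_bounds {U : Set ℂ} (hU : IsOpen U) {W : ℂ → K → ℂ}
    (hWhol : ∀ ξ : K, ξ ≠ 0 → DifferentiableOn ℂ (fun z => W z ξ) U)
    (hWbd : ∀ z₀ ∈ U, ∃ V ∈ 𝓝 z₀, ∃ (M b a : ℝ) (Cf : Set (FiniteAdeleRing (𝓞 K) K)), 0 ≤ M ∧ 0 < b ∧ IsCompact Cf ∧
      ∀ z ∈ V, ∀ ξ : K,
        ‖W z ξ‖ ≤ M * Real.exp (-(b * ‖InfiniteAdeleRing.ringEquiv_mixedSpace K (algebraMap K (AdeleRing (𝓞 K) K) ξ).1‖)) *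
          (1 + ‖InfiniteAdeleRing.ringEquiv_mixedSpace K (algebraMap K (AdeleRing (𝓞 K) K) ξ).1‖) ^ a ∧
        ((algebraMap K (AdeleRing (𝓞 K) K) ξ).2 ∉ Cf → W z ξ = 0)) :
    (∀ z ∈ U, Summable fun ξ : K => ‖W z ξ‖) ∧
    (∀ z₀ ∈ U, ∃ V ∈ 𝓝 z₀, ∃ C : ℝ, ∀ z ∈ V, ∑' ξ : K, ({0}ᶜ : Set K).indicator (fun ξ => ‖W z ξ‖) ξ ≤ C) ∧
    DifferentiableOn ℂ (fun z => ∑' ξ : K, ({0}ᶜ : Set K).indicator (fun ξ => W z ξ) ξ) U := by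
  refine summable_differentiableOn_tsum_of_rpow_bounds K hU hWhol fun z₀ hz₀ => ?_
  obtain ⟨V, hV, M, b, a, Cf, hM0, hb, hCfc, hbd⟩ := hWbd z₀ hz₀
  obtain ⟨M', hM'0, hM'⟩ := exists_exp_neg_mul_rpow_le_rpow_neg hb a ((finrank ℚ K + 1 : ℕ) : ℝ)
  refine ⟨V, hV, M * M', finrank ℚ K + 1, Cf, mul_nonneg hM0 hM'0, Nat.lt_succ_self _, hCfc, fun z hz ξ => ⟨?_, (hbd z hz ξ).2⟩⟩
  have h := hM' ‖InfiniteAdeleRing.ringEquiv_mixedSpace K (algebraMap K (AdeleRing (𝓞 K) K) ξ).1‖ (norm_nonneg _)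
  calc ‖W z ξ‖ ≤ M * Real.exp (-(b * ‖InfiniteAdeleRing.ringEquiv_mixedSpace K (algebraMap K (AdeleRing (𝓞 K) K) ξ).1‖)) *
          (1 + ‖InfiniteAdeleRing.ringEquiv_mixedSpace K (algebraMap K (AdeleRing (𝓞 K) K) ξ).1‖) ^ a := (hbd z hz ξ).1
    _ = M * (Real.exp (-(b * ‖InfiniteAdeleRing.ringEquiv_mixedSpace K (algebraMap K (AdeleRing (𝓞 K) K) ξ).1‖)) *
          (1 + ‖InfiniteAdeleRing.ringEquiv_mixedSpace K (algebraMap K (AdeleRing (𝓞 K) K) ξ).1‖) ^ a) := mul_assoc _ _ _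
    _ ≤ M * (M' * (1 + ‖InfiniteAdeleRing.ringEquiv_mixedSpace K (algebraMap K (AdeleRing (𝓞 K) K) ξ).1‖) ^ (-((finrank ℚ K + 1 : ℕ) : ℝ))) := mul_le_mul_of_nonneg_left h hM0
    _ = M * M' * (1 + ‖InfiniteAdeleRing.ringEquiv_mixedSpace K (algebraMap K (AdeleRing (𝓞 K) K) ξ).1‖) ^ (-((finrank ℚ K + 1 : ℕ) : ℝ)) := (mul_assoc _ _ _).symm

/-- **W4, ADELIC CURRENCY** (the shape of W1 ★ `eisensteinSeriesU_sub_borelConstantTerm_eq_two`: `Σ_{ξ≠0} Φ̂_g(ξ)` for an adelic `Φ̂_g`): `W : ℂ → 𝔸_K → ℂ` holomorphic in `z` at every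
rational point `ξ ≠ 0`, with around every `z₀ ∈ U` ONE exponential-times-polynomial bound and ONE compact finite support AT THE RATIONAL POINTS ⟹ the three conclusions for
`Σ_{ξ≠0} W(z, ξ)` (the lattice head at `ξ ↦ W(z, ι ξ)`). [cite: Garrett2018, §2.8] [cite: MoeglinWaldspurger1995, I.2.10] -/
theorem summable_differentiableOn_tsum_ratPoints_of_exp_bounds {U : Set ℂ} (hU : IsOpen U) {W : ℂ → AdeleRing (𝓞 K) K → ℂ}
    (hWhol : ∀ ξ : K, ξ ≠ 0 → DifferentiableOn ℂ (fun z => W z (algebraMap K (AdeleRing (𝓞 K) K) ξ)) U)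
    (hWbd : ∀ z₀ ∈ U, ∃ V ∈ 𝓝 z₀, ∃ (M b a : ℝ) (Cf : Set (FiniteAdeleRing (𝓞 K) K)), 0 ≤ M ∧ 0 < b ∧ IsCompact Cf ∧
      ∀ z ∈ V, ∀ x : AdeleRing (𝓞 K) K,
        ‖W z x‖ ≤ M * Real.exp (-(b * ‖InfiniteAdeleRing.ringEquiv_mixedSpace K x.1‖)) * (1 + ‖InfiniteAdeleRing.ringEquiv_mixedSpace K x.1‖) ^ a ∧ (x.2 ∉ Cf → W z x = 0)) :
    (∀ z ∈ U, Summable fun ξ : K => ‖W z (algebraMap K (AdeleRing (𝓞 K) K) ξ)‖) ∧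
    (∀ z₀ ∈ U, ∃ V ∈ 𝓝 z₀, ∃ C : ℝ, ∀ z ∈ V, ∑' ξ : K, ({0}ᶜ : Set K).indicator (fun ξ => ‖W z (algebraMap K (AdeleRing (𝓞 K) K) ξ)‖) ξ ≤ C) ∧
    DifferentiableOn ℂ (fun z => ∑' ξ : K, ({0}ᶜ : Set K).indicator (fun ξ => W z (algebraMap K (AdeleRing (𝓞 K) K) ξ)) ξ) U :=
  summable_differentiableOn_tsum_of_exp_bounds K hU (W := fun z ξ => W z (algebraMap K (AdeleRing (𝓞 K) K) ξ)) hWhol fun z₀ hz₀ => by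
    obtain ⟨V, hV, M, b, a, Cf, hM0, hb, hCfc, hbd⟩ := hWbd z₀ hz₀
    exact ⟨V, hV, M, b, a, Cf, hM0, hb, hCfc, fun z hz ξ => hbd z hz _⟩

/-- **W4, CONTINUITY UP TO THE BOUNDARY** (for W5's «continuous to `Re z = ½`» clause): on an arbitrary `S ⊆ ℂ`, if every `z ↦ W(z, ξ)`, `ξ ≠ 0`, is continuous on `S` and around every
`z₀ ∈ S` a neighbourhood WITHIN `S` carries ONE polynomial bound `M·(1+‖ξ_∞‖)^{−k}` (`k > [K:ℚ]`) with ONE compact `ξ_f`-support, then `z ↦ Σ_{ξ≠0} W(z, ξ)` is continuous on `S` and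
`Σ_ξ ‖W(z, ξ)‖` is summable for every `z ∈ S`. [cite: Garrett2018, §1.9–§1.10] [cite: Bump1997, §3.7] -/
theorem summable_continuousOn_tsum_of_rpow_bounds {S : Set ℂ} {W : ℂ → K → ℂ}
    (hWcont : ∀ ξ : K, ξ ≠ 0 → ContinuousOn (fun z => W z ξ) S)
    (hWbd : ∀ z₀ ∈ S, ∃ V ∈ 𝓝[S] z₀, ∃ (M : ℝ) (k : ℕ) (Cf : Set (FiniteAdeleRing (𝓞 K) K)), 0 ≤ M ∧ finrank ℚ K < k ∧ IsCompact Cf ∧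
      ∀ z ∈ V, ∀ ξ : K, ‖W z ξ‖ ≤ M * (1 + ‖InfiniteAdeleRing.ringEquiv_mixedSpace K (algebraMap K (AdeleRing (𝓞 K) K) ξ).1‖) ^ (-(k : ℝ)) ∧
        ((algebraMap K (AdeleRing (𝓞 K) K) ξ).2 ∉ Cf → W z ξ = 0)) :
    (∀ z ∈ S, Summable fun ξ : K => ‖W z ξ‖) ∧
    ContinuousOn (fun z => ∑' ξ : K, ({0}ᶜ : Set K).indicator (fun ξ => W z ξ) ξ) S := by
  have key : ∀ z₀ ∈ S, ∃ V ∈ 𝓝[S] z₀, ∃ u : K → ℝ, Summable u ∧ (∀ z ∈ V, ∀ ξ : K, ‖W z ξ‖ ≤ u ξ) ∧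
      ∀ z ∈ V, ∀ ξ : K, ‖({0}ᶜ : Set K).indicator (fun ξ => W z ξ) ξ‖ ≤ u ξ := by
    intro z₀ hz₀
    obtain ⟨V, hV, M, k, Cf, hM0, hk, hCfc, hbd⟩ := hWbd z₀ hz₀
    obtain ⟨hu, hu0⟩ := summable_majorant_ratPoints K hk hM0 hCfc
    have hdom : ∀ z ∈ V, ∀ ξ : K, ‖W z ξ‖ ≤ (if (algebraMap K (AdeleRing (𝓞 K) K) ξ).2 ∈ Cf then M * (1 + ‖InfiniteAdeleRing.ringEquiv_mixedSpace K (algebraMap K (AdeleRing (𝓞 K) K) ξ).1‖) ^ (-(k : ℝ)) else 0) := by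
      intro z hz ξ
      split_ifs with hx
      · exact (hbd z hz ξ).1
      · rw [(hbd z hz ξ).2 hx, norm_zero]
    refine ⟨V, hV, _, hu, hdom, fun z hz ξ => ?_⟩
    by_cases hξ : ξ = 0
    · simp only [hξ, Set.mem_compl_iff, Set.mem_singleton_iff, not_true_eq_false, not_false_eq_true, Set.indicator_of_notMem, norm_zero]
      exact hu0 0
    · simp only [Set.mem_compl_iff, Set.mem_singleton_iff, hξ, not_false_eq_true, Set.indicator_of_mem]
      exact hdom z hz ξ
  refine ⟨fun z hz => ?_, ?_⟩
  · obtain ⟨V, hV, u, hu, hdom, -⟩ := key z hz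
    exact Summable.of_nonneg_of_le (fun _ => norm_nonneg _) (hdom z (mem_of_mem_nhdsWithin hz hV)) hu
  · refine continuousOn_tsum_of_locally_summable_norm (fun ξ => ?_) (fun z₀ hz₀ => ?_)
    · by_cases hξ : ξ = 0
      · simp only [hξ, Set.mem_compl_iff, Set.mem_singleton_iff, not_true_eq_false, not_false_eq_true, Set.indicator_of_notMem]
        exact continuousOn_const
      · simp only [Set.mem_compl_iff, Set.mem_singleton_iff, hξ, not_false_eq_true, Set.indicator_of_mem]
        exact hWcont ξ hξ
    · obtain ⟨V, hV, u, hu, -, hdom'⟩ := key z₀ hz₀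
      exact ⟨V, hV, u, hu, fun ξ w hw => hdom' w hw ξ⟩

end Summit.HodgeConjecture.HodgeConjecture.Cruxes.H413.K2E1WhittakerSeriesConvergenceU2

end
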